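import Literature.MathematicalPhysics.QuantumFieldTheory.Balaban1983to89.B15Prop1CoerciveAtNormalisedDatum
import Literature.MathematicalPhysics.QuantumFieldTheory.Balaban1983to89.B15Prop1NearFlatPackageFromLettersLoc

/-!
# `Balaban1983to89.B15Prop1EndpointFromLetterFamiliesLoc` — [Balaban1989LargeFieldI] Prop. 1 p. 194 ∕ [Balaban1989LargeFieldII] pp. 357–360 ∕ [Balaban1985Variational] (3)–(4),
# (16)–(18), Sect. F, Prop. 9: THE COERCIVE-ROAD ENDPOINT OF THE N12∕s1 LANE FROM THE R-EXPLICIT (J0′) LETTER AND THE TWO LETTER FAMILIES, WITH THE `inputs` NEAR-FLATNESS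
# LOCALISED TO A DISPLAYED BOND NEIGHBOURHOOD (the (R-a) edition of `B15Prop1EndpointFromLetterFamilies` §1)

Honest framing: statement-level skeleton of published theorems with citation tags; proofs where landed; nothing here is a claim about the Yang–Mills mass gap.

Cell `pub-ymgap`, HUMAN RULINGS D-0062 ∕ D-0149 ∕ D-0154, width seat `pub-ymgap-dag-n12-w5` (g5) on node N12 = [B15]; count-neutral helper of K1⁹ `stmt-QuantumFields-27364`.
The lane owner dag-n12-c g19's RULING on LOCATED-CIN (pub-ymgap INBOX 2026-08-28T12:40:27Z; found by dag-n12-w6 g2): the (σ)∕(χ) letters of record ask ∕ assume near-flatness of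
the gauged minimiser on ALL of `inputs 𝐁_k(Z)`, which contains every fine bond meeting `Ω₁(Z)ᶜ` however far from `Z` — not inhabitable over the (1.74) guard for `Z ≠ 𝕋`; print's
near-flatness is LOCAL ([Balaban1989LargeFieldII] p. 357; [Balaban1985Variational] Sect. F).  REPAIR (R-a): a displayed bond neighbourhood `N i` per instance; (σ)_N delivers and
(χ)_N assumes `‖(σ • U₀) b − 1‖ ≤ δin i` only for `b ∈ inputs 𝐁_k(Z_i)` with `b ∈ N i`.  THIS FILE is `B15Prop1EndpointFromLetterFamilies.…_ofGaugeChartLetters_ofCoercive`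
(p628231) with exactly that change, over `B15Prop1NearFlatPackageFromLettersLoc.hNFn_of_letters_N_on`; everything else — (J0′) R-explicit `hMin`, the sign letters, the numerics
`hsm`∕`hγle`∕`hcJ'`, the region boxes, `hfar`, (Gᵃ) `hZblk`, `hM2`∕`hdiv`, the [15] letter `h15T`, the conclusion — VERBATIM.  The producers of (σ)_N ∕ (χ)_N: dag-n12-w6 g2's
`B15Prop1GaugeLetterGammaZeroPin.exists_gaugeLetterLoc_of_target_atRecord_box` (under its geometry letters (gN1)–(gN2) on `N i`) and dag-n12-w4's `chartLetter_of_letters_N`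
(under (gN2)–(gN3)); their geometry letters are theirs, not binders here.

WHAT THIS FILE PROVES (no `sorry`, no definition; axioms standard).
★★★ `exists_domain_prop1Printed_lfVarOn_std_su2_box_intrinsic_analytic_atZSeqCoPRecord_ofThm1TorusClass_ofMinimiserFamily_ofGaugeChartLettersN_ofCoercive` — one term:
`B15Prop1CoerciveEdition.…_ofMinimiserFamily_ofCoercive` ∘ `B15Prop1CoerciveAtNormalisedDatum.hcoer_of_nearFlatLettersNormalised_sub_loc` ∘ `hNFn_of_letters_N_on` at the box
region `𝒞 := fun i => boxBonds (LO i) (HI i)`.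

HONEST SCOPE.  One proof term over three landed theorems; (J0′), (σ)_N, (χ)_N, [15] Thm 1, the numerics remain LETTERS; count-neutral; NOT a discharge of N12; K1 NOT closed; one
finite four-torus programme at fixed `ε = L^{-K}` — nothing continuum ∕ ℝ⁴ ∕ OS ∕ mass-gap ∕ Clay.  No `def`, no `instance`, no `sorry`.

## References
* [Balaban1989LargeFieldI] T. Bałaban, Commun. Math. Phys. 122 (1989) 175–202, (1.74) p. 192, p. 193, Prop. 1 (1.77)–(1.78) p. 194, (1.79) p. 195.
* [Balaban1989LargeFieldII] T. Bałaban, Commun. Math. Phys. 122 (1989) 355–392, p. 357, (1.7)–(1.9) p. 358, (1.12)–(1.13) p. 359, (1.19) p. 360.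
* [Balaban1985Variational] T. Bałaban, Commun. Math. Phys. 102 (1985) 277–309, (3)–(4) p. 278, Thm 1 (8) p. 279, (16)–(18) p. 280, Prop. 9 (190) p. 309.
* [Balaban1988Convergent] T. Bałaban, Commun. Math. Phys. 119 (1988) 243–285, (2.2) p. 255, (2.12)–(2.14) pp. 256–257.
-/

noncomputable section

open Set Finset Metric Filter
open scoped BigOperators Matrix RealInnerProductSpace Real InnerProductSpace Topology Matrix.Norms.L2Operator

namespace Literature.MathematicalPhysics.QuantumFieldTheory.Balaban1983to89.B15Prop1EndpointFromLetterFamiliesLoc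

open B15DeterminingSets GaugeField B16Sect1Backgrounds B15Prop1Carrier B8Eq17ClassAkV1 BlockAveraging
open B15Prop1SliceTaylorCalculus
open B15Prop1CoerciveAtNormalisedDatum (hcoer_of_nearFlatLettersNormalised_sub_loc)
open B15Prop1NearFlatPackageFromLettersLoc (hNFn_of_letters_N_on)
open B15Prop1ChartCalculusSU2 (E3)
open T4CubeChartGnomonic (SU2)
open B15Prop1ChartSU2 (su2Chart)
open B15Prop1SliceCoordinates (GaugeSlice ιA freeBonds)
open B15Prop1AnalyticExtClause (cplxVec anExt)
open T4AdjointCovarianceUnitary (lieSU)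
open T4AxialGaugeSmallField (castSite boxPlaqs boxBonds)
open B6BondElimination (unitVec)
open B6TreeGaugePoincare (curl)
open B16Eq18Proof (box mem_box)
open B15Extension193 (extend)
open B15ShellGauge193 (shellGauge)
open B14.Eq213MaximalDomains (side)
open B14.Eq213DetSet B14.Eq216Concrete B15Sect1Instances B15Eq177GaugeInvariance B15Eq177ValueInvariance B15Eq177ValueInvarianceCoDiv B16Sect1Wilson
open B14.Eq22Determines (blockIter IsBlockUnion)
open Literature.MathematicalPhysics.QuantumFieldTheory.BalabanImbrieJaffe1984to88.BIJ85Eq453GaugeField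
open Node00 (expChart msChart constrCard)
open T4Continuum

variable {F : T4Family}

/-- ★★★ **PROPOSITION 1 [IV] AT PRINT'S (1.74) OBJECT — COERCIVE ROAD — FROM THE R-EXPLICIT (J0′) LETTER, THE LOCALISED GAUGE-LETTER FAMILY (σ)_N AND THE LOCALISED
CHART-LETTER FAMILY (χ)_N.**  `B15Prop1EndpointFromLetterFamilies.…_ofGaugeChartLetters_ofCoercive` (p628231) with the LOCATED-CIN repair (R-a): per instance a displayed bond
neighbourhood `N i`; the gauge letter's `inputs` clause and the chart letter's `inputs` premise are guarded by `b ∈ N i`; binder `(N : ι → Set (PBond (F.P Kt) 0))`.  Everything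
else binder for binder as in p628231.  Proof: one term over `hNFn_of_letters_N_on` at `𝒞 := fun i => boxBonds (LO i) (HI i)`.
[cite: Balaban1989LargeFieldI, (1.74) p.192, Prop. 1 (1.77)–(1.78) p.194 (incl. the last clause), (1.79) p.195; Balaban1989LargeFieldII, p.357, (1.7)–(1.9) p.358, (1.12)–(1.13) p.359;
Balaban1985Variational, (3)–(4) p.278, Thm 1 (8) p.279, (16)–(18) p.280, Prop. 9 (190) p.309; Balaban1988Convergent, (2.2) p.255, (2.12)–(2.14) pp.256–257] -/
theorem exists_domain_prop1Printed_lfVarOn_std_su2_box_intrinsic_analytic_atZSeqCoPRecord_ofThm1TorusClass_ofMinimiserFamily_ofGaugeChartLettersN_ofCoercive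
    (ν : Node00.Stage7Numerics) (Kt : ℕ) (hd3 : 3 ≤ (F.P Kt).d) (h0 : 0 < (F.P Kt).d) {ι : Type}
    (Z Λ : ι → Set (Site (F.P Kt) 0)) (k : ι → ℕ) (M : ι → ℝ) (hk0 : ∀ i, 0 < k i) (hk : ∀ i, k i ≤ (F.P Kt).m + (F.P Kt).K)
    (eR : ι → ℝ) (heR : ∀ i, 0 < eR i)
    (T : ∀ i, Finset (PBond (F.P Kt) (k i)))
    (lo hi : ι → Fin (F.P Kt).d → ℤ) (n : ι → ℕ) (hn : ∀ i κ, hi i κ ≤ lo i κ + n i) (hN : ∀ i, n i + 2 < (F.P Kt).sitesPerDir (k i))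
    (hbox : ∀ i, pts (k i) (Λ i) = (castSite '' Set.Icc (lo i) (hi i) : Set (Site (F.P Kt) (k i))))
    (hZ : ∀ i, (boxPlaqs (lo i - 1) (hi i + 1) : Set (Plaq (F.P Kt) (k i))) ⊆ plaqsInside (pts (k i) (Z i)))
    (hTG0 : ∀ i, T i = (box (fun κ => (hi i κ - lo i κ + 1).toNat) (lo i)).image fun x =>
      (⟨castSite (x - unitVec ⟨0, h0⟩), ⟨0, h0⟩⟩ : PBond (F.P Kt) (k i)))
    (hN5 : ∀ i κ, ((hi i κ - lo i κ + 1).toNat : ℤ) + 5 < (F.P Kt).sitesPerDir (k i))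
    (K : ι → ℕ) (hK1 : ∀ i, 1 ≤ K i) (hKn : ∀ i κ, (hi i κ - lo i κ + 1).toNat ≤ K i)
    (ext : ∀ i, GaugeField (F.P Kt) (k i) SU2 → GaugeField (F.P Kt) (k i) SU2)
    (hext : ∀ i Vk, ext i Vk = extend (pts (k i) (Λ i)) (shellGauge Vk (lo i) (hi i)) Vk)
    (hlohi : ∀ i, lo i ≤ hi i)
    -- the REGION parallelepipeds of the normalisation and the datum tolerances
    (LO HI : ι → Fin (F.P Kt).d → ℤ) (hLO : ∀ i, LO i ≤ lo i - 1) (hHI : ∀ i, hi i + 1 ≤ HI i) (n' : ι → ℕ) (hn' : ∀ i κ, HI i κ ≤ LO i κ + n' i)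
    (hn'N : ∀ i, n' i < (F.P Kt).sitesPerDir (k i)) (hR' : ∀ i, (boxPlaqs (LO i) (HI i) : Set (Plaq (F.P Kt) (k i))) ⊆ plaqsInside (pts (k i) (Z i)))
    (ρn : ι → ℝ)
    (hρn : ∀ i, (((F.P Kt).d : ℝ) * n' i + 1) * ((((F.P Kt).d - 1 : ℕ) : ℝ) * n' i * ((12 * (F.P Kt).d * (n i + 2) ^ 2 + 1) * eR i)
      + 3 * (F.P Kt).d * (n i + 2) ^ 2 * eR i) ≤ ρn i)
    {γ cJ bx : ℝ} (hγ : 0 < γ) (hcJ : 0 ≤ cJ) (hbx : 0 ≤ bx)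
    (hbxM : ∀ i, 12 * ((F.P Kt).d : ℝ) * ((n i : ℝ) + 2) ^ 2 ≤ bx * (M i) ^ 2)
    {R 𝓐₀ : ι → ℝ} (hM : ∀ i, 1 ≤ (M i)) (hR : ∀ i, 0 < R i)
    -- (J0′), R-EXPLICIT: per instance one radius and one bound for every base field of the strict guard
    (hMin : ∀ i Vk, PlaqSmallOn (plaqsInside (pts (k i) (Z i ∩ (Λ i)ᶜ))) (eR i) Vk →
      ∃ Ũ : VecField (F.P Kt) (k i) (EuclideanSpace ℂ (Fin 3)) × VecField (F.P Kt) (k i) (EuclideanSpace ℂ (Fin 3)) →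
          PBond (F.P Kt) 0 → Matrix (Fin 2) (Fin 2) ℂ,
        (∀ b a c, DifferentiableOn ℂ (fun z => Ũ z b a c) (ball 0 (R i))) ∧
        (∀ z ∈ ball (0 : VecField (F.P Kt) (k i) (EuclideanSpace ℂ (Fin 3)) × VecField (F.P Kt) (k i) (EuclideanSpace ℂ (Fin 3))) (R i),
          ∀ b a c, ‖Ũ z b a c‖ ≤ 𝓐₀ i) ∧
        ∀ p B' : VecField (F.P Kt) (k i) E3, ‖p‖ < R i → ‖B'‖ < R i → ∃ U' : GaugeField (F.P Kt) 0 SU2,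
          (∀ b, Ũ (cplxVec p, cplxVec B') b = ((U' b : SU2) : Matrix (Fin 2) (Fin 2) ℂ)) ∧
            IsMinimizer (Node00.avOfRecord F 2 Kt) (Node00.regMSCoPOfRecord F 2 ν Kt (k i) (maxDomT ν.M₁ (Z i))) (Bj ν.M₁ (Z i) (k i))
              (avgFamily (Node00.avOfRecord F 2 Kt) (qsstarGIter0 (k i) (expMul su2Chart B' (ext i (expMul su2Chart p Vk))))) U')
    {γ₀ : ℝ} (hγ₀ : 0 ≤ γ₀)
    {δc δin μc ρc δ₂c Kc τc : ι → ℝ} (hδc0 : ∀ i, 0 ≤ δc i) (hμc0 : ∀ i, 0 ≤ μc i) (hρc0 : ∀ i, 0 ≤ ρc i) (hδ₂c0 : ∀ i, 0 ≤ δ₂c i)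
    -- LOCATED-CIN (R-a): per instance the bond neighbourhood on which the `inputs` near-flatness is delivered ∕ asked
    (N : ι → Set (PBond (F.P Kt) 0))
    -- (σ)_N THE LOCALISED GAUGE LETTER per instance, at the guarded base fields with normalised extended datum
    (hσN : ∀ i (Vk : GaugeField (F.P Kt) (k i) SU2), PlaqSmallOn (plaqsInside (pts (k i) (Z i ∩ (Λ i)ᶜ))) (eR i) Vk →
      (∀ b ∈ (boxBonds (LO i) (HI i) : Set (PBond (F.P Kt) (k i))), dist1 (ext i Vk b) ≤ ρn i) →
      ∀ U₀ : GaugeField (F.P Kt) 0 SU2,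
        IsMinimizer (Node00.avOfRecord F 2 Kt) (Node00.regMSCoPOfRecord F 2 ν Kt (k i) (maxDomT ν.M₁ (Z i))) (Bj ν.M₁ (Z i) (k i))
          (avgFamily (Node00.avOfRecord F 2 Kt) (qsstarGIter0 (k i) (ext i Vk))) U₀ →
        ∃ σ : GaugeTransf (F.P Kt) 0 SU2,
          (∀ j, j ≤ k i → ∀ b ∈ bondsOf (Bj ν.M₁ (Z i) (k i) j), toMS σ j b.src = 1 ∧ toMS σ j b.tgt = 1) ∧
            (∀ p : Plaq (F.P Kt) 0, ((⟨p.src, p.μ⟩ : PBond (F.P Kt) 0) ∈ {b : PBond (F.P Kt) 0 | b.src ∈ maxDomT ν.M₁ (Z i) 1} ∨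
                (⟨p.src.shift p.μ, p.ν⟩ : PBond (F.P Kt) 0) ∈ {b : PBond (F.P Kt) 0 | b.src ∈ maxDomT ν.M₁ (Z i) 1} ∨
                (⟨p.src.shift p.ν, p.μ⟩ : PBond (F.P Kt) 0) ∈ {b : PBond (F.P Kt) 0 | b.src ∈ maxDomT ν.M₁ (Z i) 1} ∨
                (⟨p.src, p.ν⟩ : PBond (F.P Kt) 0) ∈ {b : PBond (F.P Kt) 0 | b.src ∈ maxDomT ν.M₁ (Z i) 1}) →
              ‖((gaugeAct σ U₀ ⟨p.src, p.μ⟩ : SU2) : Matrix (Fin 2) (Fin 2) ℂ) - 1‖ ≤ δc i ∧ ‖((gaugeAct σ U₀ ⟨p.src.shift p.μ, p.ν⟩ : SU2) : Matrix (Fin 2) (Fin 2) ℂ) - 1‖ ≤ δc i ∧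
                ‖((gaugeAct σ U₀ ⟨p.src.shift p.ν, p.μ⟩ : SU2) : Matrix (Fin 2) (Fin 2) ℂ) - 1‖ ≤ δc i ∧ ‖((gaugeAct σ U₀ ⟨p.src, p.ν⟩ : SU2) : Matrix (Fin 2) (Fin 2) ℂ) - 1‖ ≤ δc i) ∧
          (∀ b ∈ inputs (Bj ν.M₁ (Z i) (k i)), b ∈ N i → ‖((gaugeAct σ U₀ b : SU2) : Matrix (Fin 2) (Fin 2) ℂ) - 1‖ ≤ δin i))
    -- (χ)_N THE LOCALISED CHART LETTER per instance
    (hχN : ∀ i (Vk : GaugeField (F.P Kt) (k i) SU2), PlaqSmallOn (plaqsInside (pts (k i) (Z i ∩ (Λ i)ᶜ))) (eR i) Vk →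
      (∀ b ∈ (boxBonds (LO i) (HI i) : Set (PBond (F.P Kt) (k i))), dist1 (ext i Vk b) ≤ ρn i) →
      ∀ (U₀ : GaugeField (F.P Kt) 0 SU2) (Xf : GaugeSlice (pts (k i) (Λ i)) (T i) E3 → PBond (F.P Kt) 0 → lieSU (Fin 2)),
        IsMinimizer (Node00.avOfRecord F 2 Kt) (Node00.regMSCoPOfRecord F 2 ν Kt (k i) (maxDomT ν.M₁ (Z i))) (Bj ν.M₁ (Z i) (k i))
          (avgFamily (Node00.avOfRecord F 2 Kt) (qsstarGIter0 (k i) (ext i Vk))) U₀ →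
          (∀ p : Plaq (F.P Kt) 0, ((⟨p.src, p.μ⟩ : PBond (F.P Kt) 0) ∈ {b : PBond (F.P Kt) 0 | b.src ∈ maxDomT ν.M₁ (Z i) 1} ∨
              (⟨p.src.shift p.μ, p.ν⟩ : PBond (F.P Kt) 0) ∈ {b : PBond (F.P Kt) 0 | b.src ∈ maxDomT ν.M₁ (Z i) 1} ∨
              (⟨p.src.shift p.ν, p.μ⟩ : PBond (F.P Kt) 0) ∈ {b : PBond (F.P Kt) 0 | b.src ∈ maxDomT ν.M₁ (Z i) 1} ∨
              (⟨p.src, p.ν⟩ : PBond (F.P Kt) 0) ∈ {b : PBond (F.P Kt) 0 | b.src ∈ maxDomT ν.M₁ (Z i) 1}) →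
            ‖((U₀ ⟨p.src, p.μ⟩ : SU2) : Matrix (Fin 2) (Fin 2) ℂ) - 1‖ ≤ δc i ∧ ‖((U₀ ⟨p.src.shift p.μ, p.ν⟩ : SU2) : Matrix (Fin 2) (Fin 2) ℂ) - 1‖ ≤ δc i ∧
              ‖((U₀ ⟨p.src.shift p.ν, p.μ⟩ : SU2) : Matrix (Fin 2) (Fin 2) ℂ) - 1‖ ≤ δc i ∧ ‖((U₀ ⟨p.src, p.ν⟩ : SU2) : Matrix (Fin 2) (Fin 2) ℂ) - 1‖ ≤ δc i) →
        (∀ b ∈ inputs (Bj ν.M₁ (Z i) (k i)), b ∈ N i → ‖((U₀ b : SU2) : Matrix (Fin 2) (Fin 2) ℂ) - 1‖ ≤ δin i) →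
        Xf 0 = 0 → ContDiffAt ℝ 2 Xf 0 →
          (∀ᶠ Y in 𝓝 (0 : GaugeSlice (pts (k i) (Λ i)) (T i) E3),
            IsMinimizer (Node00.avOfRecord F 2 Kt) (Node00.regMSCoPOfRecord F 2 ν Kt (k i) (maxDomT ν.M₁ (Z i))) (Bj ν.M₁ (Z i) (k i))
              (avgFamily (Node00.avOfRecord F 2 Kt) (qsstarGIter0 (k i) (expMul su2Chart (ιA (pts (k i) (Λ i)) (T i) Y) (ext i Vk)))) (expChart U₀ (Xf Y))) →
        (∀ (X : GaugeSlice (pts (k i) (Λ i)) (T i) E3) (b : PBond (F.P Kt) 0),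
          ‖((fderiv ℝ Xf 0 X b : lieSU (Fin 2)) : Matrix (Fin 2) (Fin 2) ℂ)‖ ≤ 8 * 𝓐₀ i / R i * ‖X‖ ∧ ‖fderiv ℝ Xf 0 X b‖ ≤ 12 * 𝓐₀ i / R i * ‖X‖) →
        (∀ (X : GaugeSlice (pts (k i) (Λ i)) (T i) E3) (b : PBond (F.P Kt) 0), b.src ∉ maxDomT ν.M₁ (Z i) 1 → fderiv ℝ Xf 0 X b = 0) →
          ∃ (Ψ₂ : (PBond (F.P Kt) 0 → lieSU (Fin 2)) →L[ℝ] (PBond (F.P Kt) 0 → lieSU (Fin 2)) →L[ℝ] (Fin (constrCard (Bj ν.M₁ (Z i) (k i)) (k i)) → lieSU (Fin 2)))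
            (lam : (Fin (constrCard (Bj ν.M₁ (Z i) (k i)) (k i)) → lieSU (Fin 2)) →L[ℝ] ℝ)
            (p : Seminorm ℝ (PBond (F.P Kt) 0 → lieSU (Fin 2))) (q : (Fin (constrCard (Bj ν.M₁ (Z i) (k i)) (k i)) → lieSU (Fin 2)) → ℝ)
            (Lf : (PBond (F.P Kt) 0 → lieSU (Fin 2)) →L[ℝ] (Fin (constrCard (Bj ν.M₁ (Z i) (k i)) (k i)) → lieSU (Fin 2)))
            (Rf : (Fin (constrCard (Bj ν.M₁ (Z i) (k i)) (k i)) → lieSU (Fin 2)) → PBond (F.P Kt) 0 → lieSU (Fin 2)),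
            HasFDerivAt (fun Y => fderiv ℝ (msChart F 2 Kt (k i) (Bj ν.M₁ (Z i) (k i)) (avgFamily (Node00.avOfRecord F 2 Kt) (qsstarGIter0 (k i) (ext i Vk))) U₀) Y) Ψ₂ 0 ∧
            (∀ᶠ Y in 𝓝 (0 : PBond (F.P Kt) 0 → lieSU (Fin 2)),
              DifferentiableAt ℝ (msChart F 2 Kt (k i) (Bj ν.M₁ (Z i) (k i)) (avgFamily (Node00.avOfRecord F 2 Kt) (qsstarGIter0 (k i) (ext i Vk))) U₀) Y) ∧
            fderiv ℝ (fun Y : PBond (F.P Kt) 0 → lieSU (Fin 2) => wilsonAction4 (expChart U₀ Y)) 0 =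
              lam.comp (fderiv ℝ (msChart F 2 Kt (k i) (Bj ν.M₁ (Z i) (k i)) (avgFamily (Node00.avOfRecord F 2 Kt) (qsstarGIter0 (k i) (ext i Vk))) U₀) 0) ∧
            (∀ Y : PBond (F.P Kt) 0 → lieSU (Fin 2), ∑ b, ‖(Y b : Matrix (Fin 2) (Fin 2) ℂ)‖ ^ 2 ≤ p Y ^ 2) ∧
            (∀ v, Lf (Rf v) = v) ∧ (∀ v, p (Rf v) ≤ ρc i * q v) ∧
            ∀ X : GaugeSlice (pts (k i) (Λ i)) (T i) E3,
              q (fderiv ℝ (msChart F 2 Kt (k i) (Bj ν.M₁ (Z i) (k i)) (avgFamily (Node00.avOfRecord F 2 Kt) (qsstarGIter0 (k i) (ext i Vk))) U₀) 0 (fderiv ℝ Xf 0 X)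
                  - Lf (fderiv ℝ Xf 0 X)) ≤ δ₂c i * p (fderiv ℝ Xf 0 X) ∧
              lam (Ψ₂ (fderiv ℝ Xf 0 X) (fderiv ℝ Xf 0 X)) ≤ μc i * p (fderiv ℝ Xf 0 X) ^ 2 ∧
              p (fderiv ℝ Xf 0 X) ≤ Kc i * ‖X‖ ∧
              ∃ m : ℝ, (∀ w', Lf w' = fderiv ℝ (msChart F 2 Kt (k i) (Bj ν.M₁ (Z i) (k i)) (avgFamily (Node00.avOfRecord F 2 Kt) (qsstarGIter0 (k i) (ext i Vk))) U₀) 0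
                    (fderiv ℝ Xf 0 X) →
                  m ≤ fderiv ℝ (fun Y => fderiv ℝ (fun Y : PBond (F.P Kt) 0 → lieSU (Fin 2) => wilsonAction4 (expChart (1 : GaugeField (F.P Kt) 0 SU2) Y)) Y) 0 w' w') ∧
                γ₀ * (∑ z ∈ box (fun κ => (hi i κ - lo i κ + 1).toNat + 3) (fun κ => lo i κ - 2), ∑ μ : Fin (F.P Kt).d, ∑ a : Fin 3,
                    curl (fun b => ιA (pts (k i) (Λ i)) (T i) X (⟨castSite b.1, b.2⟩ : PBond (F.P Kt) (k i)) a) z ⟨0, h0⟩ μ ^ 2) - τc i * ‖X‖ ^ 2 ≤ m)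
    -- numerics: the assembled `Cerr i` (with the twist defect `τc i`) is small, and the positivity constant fits
    (hsm : ∀ i, (32 * (((F.P Kt).d : ℝ) - 1) * δc i + μc i + 16 * (((F.P Kt).d : ℝ) - 1) * (ρc i * δ₂c i) * (2 + ρc i * δ₂c i)) * Kc i ^ 2 + τc i
      ≤ γ₀ / (2 * (3 * (K i : ℝ) ^ 2 + 2 * (K i : ℝ) ^ 4)))
    (hγle : ∀ i, γ / (M i) ^ 5 ≤ γ₀ / (2 * (3 * (K i : ℝ) ^ 2 + 2 * (K i : ℝ) ^ 4)))
    (hfar : ∀ i (b : PBond (F.P Kt) 0), b.src ∉ maxDomT ν.M₁ (Z i) 1 →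
      (⟨blockIter (k i) b.src, b.dir⟩ : PBond (F.P Kt) (k i)) ∉ bondsOf (pts (k i) (Λ i)))
    (hZblk : ∀ i, IsBlockUnion (k i) (Z i))
    (hM2 : 2 ≤ ν.M₁) (hdiv : ∀ i, side (F.P Kt).L ν.M₁ (k i) ∣ (F.P Kt).sitesPerDir 0)
    {cE B₃ a₀ a₁' cA : ℝ} (hcE0 : 0 ≤ cE) (hcE : ∀ i, 12 * ((F.P Kt).d : ℝ) * ((n i : ℝ) + 2) ^ 2 ≤ cE) (hB₃ : 0 ≤ B₃)
    (heRa : ∀ i, (cE + 1) * eR i ≤ a₁' ∧ B₃ * ((cE + 1) * eR i) ≤ ν.εreg) (ha₀ : ν.εreg ≤ a₀)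
    (hcA : 1 / 2 * (B₃ * (cE + 1) * (F.P Kt).eta 1 ^ 2) ^ 2 * (Fintype.card (Plaq (F.P Kt) 0) : ℝ) ≤ cA)
    (h15T : ∀ (k' : ℕ), k' ≤ (F.P Kt).m + (F.P Kt).K → side (F.P Kt).L ν.M₁ k' ∣ (F.P Kt).sitesPerDir 0 →
      ∀ (s : B14.Eq218Concrete.Seq (fun n : ℕ => Node00.unionsOfCubes (F.P Kt) (side (F.P Kt).L ν.M₁ n)) k'),
      Node00.Sect2.SeqSeparated ν.M₁ s → 0 < ν.M₁ →
      ∀ (ε₀ : ℝ) (δ : ℕ → ℝ), (∀ j, j ≤ k' → 0 < δ j ∧ δ j ≤ a₁' ∧ B₃ * δ j ≤ ε₀) → (∀ j, j < k' → δ j ≤ 2 * δ (j + 1)) →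
      (∀ j, j < k' → δ (j + 1) ≤ 2 * δ j) → ε₀ ≤ a₀ →
      ∀ W : MSField (F.P Kt) SU2,
        Node00.Sect2.DataSmall7PTop (Node00.avOfRecord F 2 Kt) s.Ω (Node00.suppDomOfRecord F ν Kt s.Ω) k' δ W →
        ∀ U₀ : GaugeField (F.P Kt) 0 SU2, IsMinimizer (Node00.avOfRecord F 2 Kt)
            {U | (∀ j, j ≤ k' → PlaqSmallOn (Node00.Sect2.omegaPlaqsTop s.Ω (Node00.suppDomOfRecord F ν Kt s.Ω) j)
                (ε₀ * (F.P Kt).eta j ^ 2) U) ∧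
              Node00.Sect2.CoDivClassOnTop s.Ω (Node00.suppDomOfRecord F ν Kt s.Ω) k' ε₀ U}
            (genSet s.Ω k') W U₀ →
          (∀ j, j ≤ k' → PlaqSmallOn (Node00.Sect2.omegaPlaqsTop s.Ω (Node00.suppDomOfRecord F ν Kt s.Ω) j)
              (B₃ * δ j * (F.P Kt).eta j ^ 2) U₀) ∧
            ∀ j, j ≤ k' → Node00.Sect2.CoDivSmallOn (Node00.Sect2.omegaBondsTop s.Ω (Node00.suppDomOfRecord F ν Kt s.Ω) j)
              (B₃ * δ j * (F.P Kt).eta j ^ 3) U₀)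
    (hcJ' : ∀ i, 2 * cA * eR i / R i + 4 * ((Fintype.card (Plaq (F.P Kt) 0) : ℝ) * (1 + 8 * 𝓐₀ i ^ 4)) / (R i * eR i) ≤ cJ)
    : ∃ a₁ : ι → ℝ, (∀ i, 0 < a₁ i) ∧
      B15.Prop1Printed (lfVarOn su2Chart fun i =>
        InstOn.std (Node00.bgMSCoPOfRecord F 2 ν Kt (k i) (maxDomT ν.M₁ (Z i))) ν.M₁ (Z i) (Λ i) (k i) (M i) (a₁ i)
          (anExt (pts (k i) (Λ i)) (T i)
            (fun177std (Node00.bgMSCoPOfRecord F 2 ν Kt (k i) (maxDomT ν.M₁ (Z i))) ν.M₁ (Z i) (k i)) (ext i)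
            (min (1 / 2) (min (R i / 8) (γ / (M i) ^ 5 * (R i / 2) ^ 2 /
              (48 * (4 * ((Fintype.card (Plaq (F.P Kt) 0) : ℝ) * (1 + 8 * 𝓐₀ i ^ 4)) / R i + 1))))))) :=
  B15Prop1CoerciveEdition.exists_domain_prop1Printed_lfVarOn_std_su2_box_intrinsic_analytic_atZSeqCoPRecord_ofThm1TorusClass_ofMinimiserFamily_ofCoercive
    ν Kt hd3 h0 (hdec := inferInstance) (Subsingleton.elim _ _)
    Z Λ k M hk0 hk eR heR T lo hi n hn hN hbox hZ hTG0 hN5 ext hext hlohi hγ hcJ hbx hbxM hM hR hMin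
    (hcoer_of_nearFlatLettersNormalised_sub_loc ν Kt hd3 h0 Z Λ k M hk0 hk eR heR T lo hi n hn hbox hZ hTG0 hN5 K hK1 hKn ext hext hlohi
      LO HI hLO hHI n' hn' hn'N hR' ρn hρn hγ₀ hδc0 hμc0 hρc0 hδ₂c0
      (hNFn_of_letters_N_on ν Kt h0 Z Λ k hk0 hk eR T lo hi ext (fun i => (boxBonds (LO i) (HI i) : Set (PBond (F.P Kt) (k i)))) ρn hR hMin hfar N hσN hχN)
      hsm hγle hfar)
    hfar hZblk hM2 hdiv hcE0 hcE hB₃ heRa ha₀ hcA h15T hcJ'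

end Literature.MathematicalPhysics.QuantumFieldTheory.Balaban1983to89.B15Prop1EndpointFromLetterFamiliesLoc

end
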